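import Summits.QuantumAdvantage.QuantumAdvantage.Theses.CubicForrelation
import Summits.QuantumAdvantage.QuantumAdvantage.Theorems.NearExactIsExact.Negative.IdempotentPairs
import Summits.QuantumAdvantage.QuantumAdvantage.Theorems.CubicForrelationNearExactIsExactRmWeight
import Summits.QuantumAdvantage.QuantumAdvantage.Theorems.CubicForrelationNearExactIsExactDerivDegree

/-!
# `NearExactIsExact` (stmt-QuantumAdvantage-14043): the `n = 12` record idempotent `gI` is PARTNER-OPTIMAL at `57/64`

Negative-side support (B2b-3 disprover seat `b2b-cforr-disprove`, generation 9, 2026-08-20).  HONEST FRAMING: a kernel-checked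
OPTIMALITY CERTIFICATE for one explicit cubic function on 12 bits — not summit progress.

`IdempotentPairs.lean` exhibits the Frobenius-invariant cubic `gI = θ₇ ⊕ θ₃₅` on `𝔽₂¹²` and a cubic partner `fI` with
`Φ(fI, gI) = 57/64`, the largest non-exact value known at `n = 12`.  Here we prove that NO cubic partner does better:
**`Φ(f, gI) ≤ 57/64` for every cubic `f`** (`forrelation_le_of_cubic`), so `57/64 = max_f Φ(f, gI)` is attained
(`isGreatest_partner_value`).  In particular the pair `(fI, gI)` cannot be improved on the `f`-side into the open window `(15/16, 1)`.

Proof (a coset-leader argument).  Write `a(x) = (−1)^{fI(x)} W_gI(x)` (agreement values; `Σ_x a(x) = 57/64 · 2¹⁸ = 233472`).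
Computed facts, checked by `native_decide` on the fast Walsh transform of `SmallCasesWalsh.lean` (`optCheck_eq_true`): for every
`x`, `a(x) ≥ 64 − 64·[W_gI(x) = 0] − 448·[a(x) = −384]`, and `#{W_gI = 0} = 448`, `#{a = −384} = 8`.  For a cubic `f` put
`c = f ⊕ fI` (cubic); then `Σ_x (−1)^{f(x)} W_gI(x) = 233472 − 2·Σ_{c(x)=1} a(x)` and
`Σ_{c=1} a ≥ 64·|c| − 64·448 − 448·8 ≥ 64·512 − 32256 = 512 > 0` as soon as `c ≠ 0`, because a non-zero cubic on 12 bits has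
weight `≥ 2^{12−3} = 512` (Reed–Muller minimum distance, `stub_rmWeight` + `stub_derivDegree` of the tree).
References: MacWilliams–Sloane 1977 Ch. 13 §3 (weights of `RM(r,m)`); Carlet 2021 §6.1; Aaronson–Ambainis 2018 §1.1.1.
-/

set_option linter.dupNamespace false -- D-0017: single-problem summit ⇒ `QuantumAdvantage.QuantumAdvantage` by design

namespace Summit.QuantumAdvantage.QuantumAdvantage.Theorems.NearExactIsExact.Negative.IdempotentOpt

open Finset
open Literature.Computability.QuantumComplexity
open Summit.QuantumAdvantage.QuantumAdvantage.Theorems.SignedExactSliceIsLift.StubMoebius (isDegLeFun_xor)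
open Summit.QuantumAdvantage.QuantumAdvantage.Theorems.NearExactIsExact.Negative.SmallCases (sgnZ wal pt sum_pt wspec sigTable
  wal_sigTable fsumZ fsumL fsumL_eq forrelation_mul_eq_fsumZ)
open Summit.QuantumAdvantage.QuantumAdvantage.Theorems.CubicForrelation.NearExactIsExact (stub_rmWeight stub_derivDegree)
open Summit.QuantumAdvantage.QuantumAdvantage.Theorems.NearExactIsExact.Negative.IdempotentPairs (gI fI isDegLeFun_fI fsumL_fI_gI
  forrelation_fI_gI isDegLeFun_gI)

/-! ### The computed facts -/

/-- The checker: on the fast Walsh table `w` of `gI`, every code `k < 4096` satisfies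
`64 ≤ a_k + 64·[w_k = 0] + 448·[a_k = −384]` with `a_k = (−1)^{fI(k)} w_k`, and the two exceptional sets have sizes `448` and `8`.
[folklore] -/
def optCheck : Bool :=
  let w := wal (6 + 6) (sigTable (6 + 6) gI)
  ((List.range 4096).all fun k =>
      decide ((64 : ℤ) ≤ sgnZ (fI (pt (6 + 6) k)) * (w[k]?.getD 0) + (if w[k]?.getD 0 = 0 then (64 : ℤ) else 0)
        + (if sgnZ (fI (pt (6 + 6) k)) * (w[k]?.getD 0) = -384 then (448 : ℤ) else 0)))
  && (decide ((∑ k ∈ range 4096, (if (w[k]?.getD 0) = 0 then (1 : ℤ) else 0)) = 448)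
  && decide ((∑ k ∈ range 4096, (if sgnZ (fI (pt (6 + 6) k)) * (w[k]?.getD 0) = -384 then (1 : ℤ) else 0)) = 8))

/-- The checker passes. [folklore] -/
theorem optCheck_eq_true : optCheck = true := by native_decide

/-- The agreement value `a_k = (−1)^{fI(k)} W_gI(k)` at the code `k`. [folklore] -/
def aVal (k : ℕ) : ℤ := sgnZ (fI (pt (6 + 6) k)) * wspec (6 + 6) gI k

/-- Pointwise lower bound on the agreement values, read off the checker. [folklore] -/
theorem aVal_ge (k : ℕ) (hk : k < 4096) :
    (64 : ℤ) ≤ aVal k + (if wspec (6 + 6) gI k = 0 then (64 : ℤ) else 0) + (if aVal k = -384 then (448 : ℤ) else 0) := by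
  have h := optCheck_eq_true
  simp only [optCheck, Bool.and_eq_true, decide_eq_true_eq, List.all_eq_true, List.mem_range] at h
  have h1 := h.1 k hk
  rw [wal_sigTable (6 + 6) gI k (by norm_num; exact hk)] at h1
  exact h1

/-- `#{W_gI = 0} = 448` on codes. [folklore] -/
theorem sum_zero_ind : (∑ k ∈ range 4096, (if wspec (6 + 6) gI k = 0 then (1 : ℤ) else 0)) = 448 := by
  have h := optCheck_eq_true
  simp only [optCheck, Bool.and_eq_true, decide_eq_true_eq, List.all_eq_true, List.mem_range] at h
  rw [← h.2.1]
  refine sum_congr rfl fun k hk => ?_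
  rw [wal_sigTable (6 + 6) gI k (by norm_num; exact mem_range.1 hk)]

/-- `#{a = −384} = 8` on codes. [folklore] -/
theorem sum_defect_ind : (∑ k ∈ range 4096, (if aVal k = -384 then (1 : ℤ) else 0)) = 8 := by
  have h := optCheck_eq_true
  simp only [optCheck, Bool.and_eq_true, decide_eq_true_eq, List.all_eq_true, List.mem_range] at h
  rw [← h.2.2]
  refine sum_congr rfl fun k hk => ?_
  rw [aVal, wal_sigTable (6 + 6) gI k (by norm_num; exact mem_range.1 hk)]

/-- `Σ_k a_k = fsumZ fI gI = 233472`. [folklore] -/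
theorem sum_aVal : (∑ k ∈ range 4096, aVal k) = 233472 := by
  have h : fsumZ (6 + 6) fI gI = 233472 := by rw [← fsumL_eq]; exact fsumL_fI_gI
  rw [fsumZ] at h
  rw [show (4096 : ℕ) = 2 ^ (6 + 6) by norm_num]
  exact h

/-! ### The coset-leader argument -/

/-- `(−1)^{a ⊕ b} = (−1)^a (−1)^b`. [folklore] -/
theorem sgnZ_xor (a b : Bool) : sgnZ (xor a b) = sgnZ a * sgnZ b := by
  cases a <;> cases b <;> simp [sgnZ]

/-- `(−1)^b = 1 − 2[b]`. [folklore] -/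
theorem sgnZ_eq_ind (b : Bool) : sgnZ b = 1 - 2 * (if b = true then (1 : ℤ) else 0) := by
  cases b <;> simp [sgnZ]

/-- A non-zero cubic on 12 bits has at least `512` ones among the codes. [cite: MacWilliamsSloane1977, Ch. 13 §3 Thm 3] -/
theorem weight_ge_of_cubic (c : (Fin (6 + 6) → Bool) → Bool) (hc : IsDegLeFun 3 c) (hx : ∃ x, c x = true) :
    (512 : ℤ) ≤ ∑ k ∈ range 4096, (if c (pt (6 + 6) k) = true then (1 : ℤ) else 0) := by
  have hw := stub_rmWeight stub_derivDegree (6 + 6) 3 c hc hx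
  have hcard : ((univ.filter fun x => c x = true).card : ℤ) =
      ∑ k ∈ range 4096, (if c (pt (6 + 6) k) = true then (1 : ℤ) else 0) := by
    rw [show (4096 : ℕ) = 2 ^ (6 + 6) by norm_num, ← sum_pt (6 + 6) (fun x => if c x = true then (1 : ℤ) else 0)]
    rw [sum_boole]
  rw [← hcard]
  have : 2 ^ (6 + 6) ≤ 2 ^ 3 * (univ.filter fun x => c x = true).card := hw
  norm_num at this
  exact_mod_cast (by omega : 512 ≤ (univ.filter fun x => c x = true).card)

/-- **The forrelation sum against `gI` is at most `233472 = (57/64)·2¹⁸` for every cubic `f`.** [folklore] -/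
theorem fsumZ_le_of_cubic (f : (Fin (6 + 6) → Bool) → Bool) (hf : IsDegLeFun 3 f) :
    fsumZ (6 + 6) f gI ≤ 233472 := by
  -- the cubic difference `c = f ⊕ fI`
  set c : (Fin (6 + 6) → Bool) → Bool := fun x => xor (f x) (fI x) with hc_def
  have hc : IsDegLeFun 3 c := isDegLeFun_xor hf isDegLeFun_fI
  have hfx : ∀ x, f x = xor (c x) (fI x) := fun x => by
    simp only [hc_def]; cases f x <;> cases fI x <;> rfl
  -- rewrite the sum: `fsumZ f gI = Σ a_k − 2 Σ_{c} a_k`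
  have hsum : fsumZ (6 + 6) f gI =
      (∑ k ∈ range 4096, aVal k) - 2 * ∑ k ∈ range 4096, (if c (pt (6 + 6) k) = true then aVal k else 0) := by
    rw [fsumZ, show (2 : ℕ) ^ (6 + 6) = 4096 by norm_num, mul_sum, ← sum_sub_distrib]
    refine sum_congr rfl fun k _ => ?_
    rw [hfx, sgnZ_xor, sgnZ_eq_ind, aVal]
    split_ifs <;> ring
  rw [hsum, sum_aVal]
  -- it remains to see that the defect sum `S = Σ_{c} a_k` is non-negative
  suffices hS : (0 : ℤ) ≤ ∑ k ∈ range 4096, (if c (pt (6 + 6) k) = true then aVal k else 0) by linarith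
  by_cases hx : ∃ x, c x = true
  · -- `c ≠ 0`: pointwise bound, then the Reed–Muller weight bound
    have hpt : ∀ k ∈ range 4096, 64 * (if c (pt (6 + 6) k) = true then (1 : ℤ) else 0)
        - 64 * (if wspec (6 + 6) gI k = 0 then (1 : ℤ) else 0) - 448 * (if aVal k = -384 then (1 : ℤ) else 0)
        ≤ (if c (pt (6 + 6) k) = true then aVal k else 0) := by
      intro k hk
      have h := aVal_ge k (mem_range.1 hk)
      split_ifs at h ⊢ <;> linarith
    have hle := sum_le_sum hpt
    rw [sum_sub_distrib, sum_sub_distrib, ← mul_sum, ← mul_sum, ← mul_sum, sum_zero_ind, sum_defect_ind] at hle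
    have hw := weight_ge_of_cubic c hc hx
    linarith
  · -- `c = 0`: the defect sum is empty
    push Not at hx
    refine sum_nonneg fun k _ => ?_
    simp [hx]

/-- **Partner-optimality of `gI`: `Φ(f, gI) ≤ 57/64` for every cubic `f` on 12 bits.** [folklore] -/
theorem forrelation_le_of_cubic (f : (Fin (6 + 6) → Bool) → Bool) (hf : IsDegLeFun 3 f) :
    forrelation f gI ≤ 57 / 64 := by
  have h := forrelation_mul_eq_fsumZ 6 f gI
  have hle : (fsumZ (6 + 6) f gI : ℝ) ≤ 233472 := by exact_mod_cast fsumZ_le_of_cubic f hf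
  have hpos : (0 : ℝ) < (2 : ℝ) ^ (3 * 6) := by positivity
  have : forrelation f gI * (2 : ℝ) ^ (3 * 6) ≤ 233472 := by rw [h]; exact hle
  have h2 : (2 : ℝ) ^ (3 * 6) = 262144 := by norm_num
  rw [h2] at this
  linarith

/-- **`57/64` is the maximum of `Φ(·, gI)` over cubic partners** (attained by `fI`). [folklore] -/
theorem isGreatest_partner_value :
    IsGreatest {φ : ℝ | ∃ f : (Fin (6 + 6) → Bool) → Bool, IsDegLeFun 3 f ∧ forrelation f gI = φ} (57 / 64) :=
  ⟨⟨fI, isDegLeFun_fI, forrelation_fI_gI⟩, fun _ ⟨f, hf, hφ⟩ => hφ ▸ forrelation_le_of_cubic f hf⟩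

/-- **No cubic partner lifts `gI` into the open window `(15/16, 1)`** — the `f`-side of the record pair is closed.
[folklore] -/
theorem no_window_partner (f : (Fin (6 + 6) → Bool) → Bool) (hf : IsDegLeFun 3 f) :
    ¬ (15 / 16 < forrelation f gI) := by
  have := forrelation_le_of_cubic f hf
  intro h; linarith

end Summit.QuantumAdvantage.QuantumAdvantage.Theorems.NearExactIsExact.Negative.IdempotentOpt
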